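import Literature.MathematicalPhysics.QuantumFieldTheory.Balaban1983to89.B9Thm311FormGapOfLawsAtLettersY
import Literature.MathematicalPhysics.QuantumFieldTheory.Balaban1983to89.B9B8KnitLetterProjectionC
import Literature.MathematicalPhysics.QuantumFieldTheory.Balaban1983to89.B9Eq3124HZKnitPairReg335Y
import Literature.MathematicalPhysics.QuantumFieldTheory.Balaban1983to89.Node00.OpsYQLetter

/-!
# `Balaban1983to89.B9Thm311PosDefQknitAtKnitSiteTableY` — Theorem 3.11's gap and row 17 at the knit letter AT THE KNIT SITE TABLE
# `(parKnitY, GpY parKnitY)`: of the four displayed laws of `B9Thm311FormGapOfLawsAtLettersY`, two (`Δ_a(U)` symmetric, `R(U) ≥ 0`) are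
# THEOREMS at `parKnitY` on (3.35) — only Theorem 3.3's block remains displayed

T. Bałaban, *Propagators for lattice gauge theories in a background field*, Commun. Math. Phys. **99** (1985) 389–434
[`Balaban1985BackgroundPropagators`, "B9"]; T. Bałaban, *Averaging operations for lattice gauge theories*, Commun. Math. Phys. **98** (1985) 17–51
[`Balaban1985Averaging`, "B7"]; [4] = *Propagators … II*, Commun. Math. Phys. **96** (1984) 223–250 [`Balaban1984PropagatorsII`].

THE PRINT.  Thm 3.11 p. 416 (*"Δ_a(U) … is a symmetric and invertible operator"*); (3.20)–(3.21) p. 394 (`R(U)` *"the orthogonal projection"*);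
(3.24)–(3.27) pp. 394–395; Thm 3.3 p. 399 ((3.42) for `G = Δ_a⁻¹`); (3.35) p. 396 (*"U has values in G"*); [B7] Prop. 2 p. 26 (the averages stay in
the group, hence the contour variables `U(Γ)` of (3.19) p. 393 are unitary).

WHY THIS FILE (cell `pub-ymgap`, node N06, seat `dag-n06-j` = bundle F5, gen 35; CASCADE-K).  `B9Thm311FormGapOfLawsAtLettersY` (✓) re-presses the
scale-weighted gap of `Δ_a(U)` and row 17 at the knit averaging letter `QknitY` at a PARAMETRIC site transporter `(parS, Gp)`, displaying four laws at the
configuration: Theorem 3.3's block (`IsUnit Δ_a(U)`, `EBlock` of `G = Δ_a⁻¹`), `Δ_a(U)` symmetric, `⟨f, R(U)f⟩ ≥ 0`.  The «K» certificate of dag-n06-d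
instantiates them at the KNIT site table `parS := parKnitY`, `Gp := GpY parKnitY`.  THERE the last two laws are theorems already in the tree: on (3.35) with
the x-free numerics of the knit chain the knit legs are `U(N)`-valued (`B9Eq3124HZKnitPairReg335Y.parKnitY_mem_unitary_of_reg335P`), whence `Δ′_a(U; parKnitY)`
is symmetric (`B9B8KnitLetterGpDecay.symm0_parKnitY`), `Q′\*` is the adjoint of `Q′` (`B9B8KnitLetterProjectionC.adj_parKnitY`), so `Δ_a(U; parKnitY)` is
symmetric (`B9Thm311Curv2Symm.deltaAY_isSymmTr`), and `R(U; parKnitY)` is a symmetric idempotent with `⟨f, Rf⟩ = ‖Rf‖² ≥ 0`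
(`B9B8KnitLetterProjectionC.trIP_RY_parKnitY_self_nonneg`).  THIS FILE discharges the two laws BY NAME: the gap and row 17 at the knit site table
display ONLY Theorem 3.3's block at `parKnitY` (the open K2 law; locator Thm 3.3 p. 399) — plus, for row 17, the adjointness of the pair `(QknitY, 𝔮s)`
and the x-free numerics, exactly as in `B9Thm311PosDefQknitOfRegYP335AtLettersY` (✓).

WHAT IS PROVED (sorry-free; 0 `def`).  `parKnitY_mem_unitary_at_member` (the knit legs of an `SU(N)`-valued member of (3.35) are unitary, numerics
`0 < α₀′ ≤ α_Q`, `K_pl(Mα₀)L⁴ < α₀′`) · `deltaAY_parKnitY_isSymmTr_at_member` · `trIP_RY_parKnitY_self_nonneg_at_member` · ★★★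
`formGap_deltaAY_parKnitY_of_block` — `∃ M₁ a₁ γ > 0, … ∀ U ∈ (bg9YP … x).Reg335 c₃₅ α₀, (numerics) → IsUnit Δ_a(U; parKnitY) → EBlock (… GAY parKnitY
parBY (GpY parKnitY) …) K_A δ_A U → ∀ A, γ·Σ_b c_f²(L^{lev b})⁻²‖A b‖²_HS ≤ ⟨A, Δ_a(U; parKnitY)A⟩₁` · ★★★ `posDefTr_deltaAQY_QknitY_parKnitY_of_block` — row 17
`PosDefTr 1 (deltaAQY x (QknitY x) 𝔮s parKnitY (GpY parKnitY) U)` from Theorem 3.3's block at `parKnitY`, the adjointness of `(QknitY x U, 𝔮s U)` and the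
numerics `0 < α₀′ ≤ α_Q`, `K_pl(Mα₀)L⁴ < α₀′`, `δ(2√(2b₁)+δ) < γ`.
HONEST SCOPE.  Two displayed laws of the parametric re-press discharged at one table by landed theorems; Theorem 3.3's block at `parKnitY` is NOT proved
here; NOT a node discharge; count-neutral; nothing continuum ∕ OS ∕ mass gap ∕ Clay.  No `sorry`, no `axiom`, no `instance`, no `notation`, no `def`.
-/

noncomputable section

namespace Literature.MathematicalPhysics.QuantumFieldTheory.Balaban1983to89.B9Thm311PosDefQknitAtKnitSiteTableY

open Literature.MathematicalPhysics.QuantumFieldTheory.Balaban1983to89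
open B9Thm311ReadingCoords B9Thm39ReadingCoords B9Thm39ReadingAtLetters Node00
open B6KLevelCensusIndexV1 B6Ineq2142KLevelV1 B6GlobalChartV1 B9PinMembersKLevelV1 B9PinGeometryKLevelV1 B9GeoNormsKLevelV1
  B9BackgroundsKLevelV1 B9BackgroundsKLevelV1P
open B9Thm311FormGapOfLawsAtLettersY
open Literature.MathematicalPhysics.QuantumFieldTheory.Balaban1983to89.B9FromB6 (EBlock)
open Literature.MathematicalPhysics.QuantumFieldTheory.Balaban1983to89.B9CubeLettersInvReadings (kernelFamilyBInv)
open Literature.MathematicalPhysics.QuantumFieldTheory.Balaban1983to89.B9Thm39OneCubeReadingAtLettersY (geo9Y_M_nonneg)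
open Literature.MathematicalPhysics.QuantumFieldTheory.Balaban1983to89.B9B8AveragingJunction (parKnitY)
open Literature.MathematicalPhysics.QuantumFieldTheory.Balaban1983to89.B9B8KnitLetterProjectionC (adj_parKnitY trIP_RY_parKnitY_self_nonneg)
open Literature.MathematicalPhysics.QuantumFieldTheory.Balaban1983to89.B9B8KnitLetterGpDecay (symm0_parKnitY)
open Literature.MathematicalPhysics.QuantumFieldTheory.Balaban1983to89.B9Eq3124HZKnitPairReg335Y (parKnitY_mem_unitary_of_reg335P)
open Literature.MathematicalPhysics.QuantumFieldTheory.Balaban1983to89.B9Thm311Curv2Symm (deltaAY_isSymmTr)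
open Literature.MathematicalPhysics.QuantumFieldTheory.Balaban1983to89.B9Eq3115KnitLetterY (QknitY)
open Literature.MathematicalPhysics.QuantumFieldTheory.Balaban1983to89.B9Eq3115KnitLetterYOnto (kCol)
open Literature.MathematicalPhysics.QuantumFieldTheory.Balaban1983to89.B9Eq316AveragingTransposeZd (alphaQ C0_mul_alphaQ_le four_mul_alphaQ_le)
open Literature.MathematicalPhysics.QuantumFieldTheory.Balaban1983to89.B9C2FormBoxRegimeY (Kpl)

section Record

open scoped Matrix.Norms.L2Operator
open B7Prop2SpecialUnitary

variable {N : ℕ} [Nonempty (Fin N)] (θ : Stage3Params) (Mstar : ℕ)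

/-! ## §1 The two structural laws at the knit site table are theorems on (3.35) -/

/-- **THE KNIT LEGS OF A MEMBER ON (3.35) ARE UNITARY**: for an `SU(N)`-valued `U ∈ (bg9YP … x).Reg335 c₃₅ α₀` (`0 < α₀`) and the x-free numerics
`0 < α₀′ ≤ α_Q`, `K_pl(Mα₀)L⁴ < α₀′`, every value of `parKnitY x U` is in `U(N)` (dag-n06-l's `parKnitY_mem_unitary_of_reg335P`, the two [B7] Prop. 2
windows read off `α_Q`). [cite: Balaban1985BackgroundPropagators, (3.19) p.393, (3.35) p.396; Balaban1985Averaging, Prop. 2 (52)–(53) p.26] -/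
theorem parKnitY_mem_unitary_at_member (x : MemberY θ.d₆ θ.ℓ₆ θ.hd' θ.hL' θ.b₀ θ.b₁ Mstar) {α₀ : ℝ} (hα : 0 < α₀)
    {U : CfgY (Matrix (Fin N) (Fin N) ℂ) x.toKIdx} (hU : (bg9YP (Matrix (Fin N) (Fin N) ℂ) (specialUnitaryUnits (Fin N)) x).Reg335 c35Y α₀ U)
    {α₀' : ℝ} (hα' : 0 < α₀') (hαQ : α₀' ≤ alphaQ (θ.d₆ + 1) (θ.ℓ₆ + 1))
    (hK : Kpl x.toKIdx ((geo9Y x).M * α₀) * (((θ.ℓ₆ : ℝ) + 1)) ^ 4 < α₀') (z w : SiteY x.toKIdx) :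
    parKnitY x.toKIdx U z w ∈ B7Prop2Explicit.unitaryUnits (Matrix (Fin N) (Fin N) ℂ) := by
  have hGU : specialUnitaryUnits (Fin N) ≤ B7Prop2Explicit.unitaryUnits (Matrix (Fin N) (Fin N) ℂ) := specialUnitaryUnits_le_unitaryUnits
  have hG1 : ∀ u : (Matrix (Fin N) (Fin N) ℂ)ˣ, u ∈ specialUnitaryUnits (Fin N) → ‖(u : Matrix (Fin N) (Fin N) ℂ)‖ ≤ 1 :=
    fun u hu => (B9Ineq349SiteFromConv342.contractive_of_mem hGU hu).1
  have hMα : 0 ≤ (kGeo x.toKIdx).M * α₀ := mul_nonneg (geo9Y_M_nonneg θ Mstar x) hα.le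
  have hLK : (kGeo x.toKIdx).L = (θ.ℓ₆ : ℝ) + 1 := by show (((θ.ℓ₆ + 1 : ℕ) : ℝ)) = _; push_cast; ring
  have hK' : Kpl x.toKIdx ((kGeo x.toKIdx).M * α₀) * (kGeo x.toKIdx).L ^ 4 < α₀' := by rw [hLK]; exact hK
  have hα3 : B7Prop2Explicit.C0 (θ.d₆ + 1) * α₀' ≤ 1 / 3 :=
    (mul_le_mul_of_nonneg_left hαQ (B7Prop2Explicit.C0_pos _).le).trans (C0_mul_alphaQ_le _ _)
  have hα2 : 2 * α₀' ≤ B7Prop2Explicit.c2' (θ.d₆ + 1) (θ.ℓ₆ + 1) := by linarith [four_mul_alphaQ_le (θ.d₆ + 1) (θ.ℓ₆ + 1)]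
  exact parKnitY_mem_unitary_of_reg335P x.toKIdx hG1 hGU U (show c35Y ≤ 10 by norm_num [c35Y]) hMα hU.1 hα' hα3 hα2 hK' z w

/-- **`Δ_a(U; parKnitY)` IS SYMMETRIC** for the trace pairing at such members (print p. 416: *"a symmetric … operator"*): `Δ′_a(U; parKnitY)` is symmetric
(`symm0_parKnitY`), `Q′\*` is the adjoint of `Q′` (`adj_parKnitY`), the taxi legs `parBY` are `SU(N)`-valued — fed to `deltaAY_isSymmTr`.
[cite: Balaban1985BackgroundPropagators, (3.24)–(3.27) pp.394–395, Thm 3.11 p.416] -/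
theorem deltaAY_parKnitY_isSymmTr_at_member (x : MemberY θ.d₆ θ.ℓ₆ θ.hd' θ.hL' θ.b₀ θ.b₁ Mstar) {α₀ : ℝ} (hα : 0 < α₀)
    {U : CfgY (Matrix (Fin N) (Fin N) ℂ) x.toKIdx} (hU : (bg9YP (Matrix (Fin N) (Fin N) ℂ) (specialUnitaryUnits (Fin N)) x).Reg335 c35Y α₀ U)
    {α₀' : ℝ} (hα' : 0 < α₀') (hαQ : α₀' ≤ alphaQ (θ.d₆ + 1) (θ.ℓ₆ + 1))
    (hK : Kpl x.toKIdx ((geo9Y x).M * α₀) * (((θ.ℓ₆ : ℝ) + 1)) ^ 4 < α₀') :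
    IsSymmTr (fun _ => (1 : ℝ)) (deltaAY x.toKIdx (parKnitY x.toKIdx) (parBY x.toKIdx) (GpY x.toKIdx (parKnitY x.toKIdx)) U) := by
  have hGU : specialUnitaryUnits (Fin N) ≤ B7Prop2Explicit.unitaryUnits (Matrix (Fin N) (Fin N) ℂ) := specialUnitaryUnits_le_unitaryUnits
  have hpar := parKnitY_mem_unitary_at_member θ Mstar x hα hU hα' hαQ hK
  have hU' : ∀ μ y, U μ y ∈ B7Prop2Explicit.unitaryUnits (Matrix (Fin N) (Fin N) ℂ) := fun μ y => hGU (hU.1.1 μ y)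
  exact deltaAY_isSymmTr x.toKIdx le_rfl (parKnitY x.toKIdx) (parBY x.toKIdx) U hU' (fun s s' => parBY_mem x.toKIdx hU' s s')
    (symm0_parKnitY x.toKIdx le_rfl hU' hpar) (adj_parKnitY x.toKIdx le_rfl U hpar)

/-- **`⟨f, R(U; parKnitY)f⟩ ≥ 0`** at such members: `R(U)` at the knit site table is a symmetric idempotent (`trIP_RY_parKnitY_self_nonneg`).
[cite: Balaban1985BackgroundPropagators, (3.20)–(3.21) p.394, (3.25) p.395] -/
theorem trIP_RY_parKnitY_self_nonneg_at_member (x : MemberY θ.d₆ θ.ℓ₆ θ.hd' θ.hL' θ.b₀ θ.b₁ Mstar) {α₀ : ℝ} (hα : 0 < α₀)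
    {U : CfgY (Matrix (Fin N) (Fin N) ℂ) x.toKIdx} (hU : (bg9YP (Matrix (Fin N) (Fin N) ℂ) (specialUnitaryUnits (Fin N)) x).Reg335 c35Y α₀ U)
    {α₀' : ℝ} (hα' : 0 < α₀') (hαQ : α₀' ≤ alphaQ (θ.d₆ + 1) (θ.ℓ₆ + 1))
    (hK : Kpl x.toKIdx ((geo9Y x).M * α₀) * (((θ.ℓ₆ : ℝ) + 1)) ^ 4 < α₀') (f : SiteY x.toKIdx → Matrix (Fin N) (Fin N) ℂ) :
    0 ≤ trIP (fun _ => (1 : ℝ)) f (RY x.toKIdx (parKnitY x.toKIdx) (GpY x.toKIdx (parKnitY x.toKIdx)) U f) := by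
  have hGU : specialUnitaryUnits (Fin N) ≤ B7Prop2Explicit.unitaryUnits (Matrix (Fin N) (Fin N) ℂ) := specialUnitaryUnits_le_unitaryUnits
  have hpar := parKnitY_mem_unitary_at_member θ Mstar x hα hU hα' hαQ hK
  exact trIP_RY_parKnitY_self_nonneg x.toKIdx le_rfl (fun μ y => hGU (hU.1.1 μ y)) hpar f

/-! ## §2 ★★★ The gap and row 17 at the knit site table from Theorem 3.3's block alone -/

/-- ★★★ **THEOREM 3.11's SCALE-WEIGHTED GAP AT THE KNIT SITE TABLE `(parKnitY, GpY parKnitY)`** at section-carrying members on (3.35): for `δ_A > 0`,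
`K_A ≥ 0` there are `M₁, a₁, γ > 0` with: `β` onto, `M₁ ≦ M`, `0 < α₀`, `Mα₀ ≦ a₁`, `SU(N)`-valued `U ∈ (bg9YP … x).Reg335 c₃₅ α₀`, numerics `0 < α₀′ ≤ α_Q`,
`K_pl(Mα₀)L⁴ < α₀′`, and Theorem 3.3's block AT `parKnitY` (`IsUnit Δ_a(U)`, `EBlock` of `G = Δ_a⁻¹` with `(K_A, δ_A)`) ⟹
`γ·Σ_b c_f²(L^{lev b})⁻²‖A b‖²_HS ≤ ⟨A, Δ_a(U; parKnitY)A⟩₁`.  The symmetry and `R ≥ 0` laws of `formGap_deltaAY_of_laws` are discharged by §1.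
[cite: Balaban1985BackgroundPropagators, Thm 3.11 p.416; Thm 3.3 p.399; (3.26) p.395; (3.35) p.396; Balaban1984PropagatorsII, Lemma 2.1 (2.60)–(2.61) p.234] -/
theorem formGap_deltaAY_parKnitY_of_block {δA KA : ℝ} (hδA : 0 < δA) (hKA : 0 ≤ KA) :
    ∃ M₁ a₁ γ : ℝ, 0 < M₁ ∧ 0 < a₁ ∧ 0 < γ ∧
    ∀ (x : MemberY θ.d₆ θ.ℓ₆ θ.hd' θ.hL' θ.b₀ θ.b₁ Mstar), Function.Surjective (β x.hN x.D x.hk) → M₁ ≤ (geo9Y x).M →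
      ∀ α₀ : ℝ, 0 < α₀ → (geo9Y x).M * α₀ ≤ a₁ →
      ∀ U : CfgY (Matrix (Fin N) (Fin N) ℂ) x.toKIdx,
        (bg9YP (Matrix (Fin N) (Fin N) ℂ) (specialUnitaryUnits (Fin N)) x).Reg335 c35Y α₀ U →
        ∀ α₀' : ℝ, 0 < α₀' → α₀' ≤ alphaQ (θ.d₆ + 1) (θ.ℓ₆ + 1) →
          Kpl x.toKIdx ((geo9Y x).M * α₀) * (((θ.ℓ₆ : ℝ) + 1)) ^ 4 < α₀' →
          IsUnit (deltaAY x.toKIdx (parKnitY x.toKIdx) (parBY x.toKIdx) (GpY x.toKIdx (parKnitY x.toKIdx)) U) →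
          EBlock (kernelFamilyBInv x.toKIdx (bg9YP (Matrix (Fin N) (Fin N) ℂ) (specialUnitaryUnits (Fin N)) x) (fun V => V)
            (GAY x.toKIdx (parKnitY x.toKIdx) (parBY x.toKIdx) (GpY x.toKIdx (parKnitY x.toKIdx))) (parBY x.toKIdx)) KA δA U →
        ∀ A : FBondY x.toKIdx → Matrix (Fin N) (Fin N) ℂ,
          γ * ∑ b, (x.toKIdx.cf ^ 2 * ((((θ.ℓ₆ : ℝ) + 1) ^ levV1 x.toKIdx b.src)⁻¹) ^ 2) * ∑ a, ∑ c, ‖A b a c‖ ^ 2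
            ≤ trIP (fun _ => (1 : ℝ)) A
                (deltaAY x.toKIdx (parKnitY x.toKIdx) (parBY x.toKIdx) (GpY x.toKIdx (parKnitY x.toKIdx)) U A) := by
  have hN : 1 ≤ N := Fin.pos_iff_nonempty.2 inferInstance
  obtain ⟨M₁, a₁, γ, hM₁, ha₁, hγ, h⟩ := formGap_deltaAY_of_laws (N := N) θ Mstar hN hδA hKA
  refine ⟨M₁, a₁, γ, hM₁, ha₁, hγ, fun x hsurj hM α₀ hα ha U hU α₀' hα' hαQ hK hunit hE A => ?_⟩
  exact h x hsurj hM α₀ hα ha U hU (parKnitY x.toKIdx) (GpY x.toKIdx (parKnitY x.toKIdx)) hunit hE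
    (deltaAY_parKnitY_isSymmTr_at_member θ Mstar x hα hU hα' hαQ hK)
    (trIP_RY_parKnitY_self_nonneg_at_member θ Mstar x hα hU hα' hαQ hK) A

/-- ★★★ **ROW 17 AT THE KNIT LETTER AT THE KNIT SITE TABLE** — the displayed law `hΔAK` of dag-n06-d's «K» certificate REDUCED TO THEOREM 3.3's
BLOCK: at section-carrying members on (3.35), with Theorem 3.3's block at `parKnitY` (`IsUnit Δ_a(U; parKnitY)` + `EBlock (K_A, δ_A)` of `G = Δ_a⁻¹`),
a partner `𝔮s` adjoint to `QknitY x` at `U`, and the x-free numerics `0 < α₀′ ≤ α_Q`, `K_pl(Mα₀)L⁴ < α₀′`, `δ(2√(2b₁)+δ) < γ` (`δ = α₀′m₀√(2Nb₁)`):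
`PosDefTr 1 (deltaAQY x (QknitY x) 𝔮s parKnitY (GpY parKnitY) U)`. [cite: Balaban1985BackgroundPropagators, Thm 3.11 p.416; Thm 3.3 p.399;
(3.20)–(3.27) pp.394–395; (3.35) p.396; (3.115) p.419; Balaban1985Averaging, Prop. 2 p.26, (139)–(147) pp.39–40] -/
theorem posDefTr_deltaAQY_QknitY_parKnitY_of_block {δA KA : ℝ} (hδA : 0 < δA) (hKA : 0 ≤ KA) :
    ∃ M₁ a₁ γ : ℝ, 0 < M₁ ∧ 0 < a₁ ∧ 0 < γ ∧
    ∀ (x : MemberY θ.d₆ θ.ℓ₆ θ.hd' θ.hL' θ.b₀ θ.b₁ Mstar), Function.Surjective (β x.hN x.D x.hk) → M₁ ≤ (geo9Y x).M →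
      ∀ α₀ : ℝ, 0 < α₀ → (geo9Y x).M * α₀ ≤ a₁ →
      ∀ U : CfgY (Matrix (Fin N) (Fin N) ℂ) x.toKIdx,
        (bg9YP (Matrix (Fin N) (Fin N) ℂ) (specialUnitaryUnits (Fin N)) x).Reg335 c35Y α₀ U →
          IsUnit (deltaAY x.toKIdx (parKnitY x.toKIdx) (parBY x.toKIdx) (GpY x.toKIdx (parKnitY x.toKIdx)) U) →
          EBlock (kernelFamilyBInv x.toKIdx (bg9YP (Matrix (Fin N) (Fin N) ℂ) (specialUnitaryUnits (Fin N)) x) (fun V => V)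
            (GAY x.toKIdx (parKnitY x.toKIdx) (parBY x.toKIdx) (GpY x.toKIdx (parKnitY x.toKIdx))) (parBY x.toKIdx)) KA δA U →
        ∀ (𝔮s : CfgY (Matrix (Fin N) (Fin N) ℂ) x.toKIdx →
              ((IBondY x.toKIdx → Matrix (Fin N) (Fin N) ℂ) →ₗ[ℂ] (FBondY x.toKIdx → Matrix (Fin N) (Fin N) ℂ))),
          IsAdjTr (fun _ => (1 : ℝ)) (fun _ => (1 : ℝ)) (QknitY x.toKIdx U) (𝔮s U) →
        ∀ α₀' : ℝ, 0 < α₀' → α₀' ≤ alphaQ (θ.d₆ + 1) (θ.ℓ₆ + 1) →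
          Kpl x.toKIdx ((geo9Y x).M * α₀) * (((θ.ℓ₆ : ℝ) + 1)) ^ 4 < α₀' →
          (α₀' * (2 * ((θ.d₆ : ℝ) + 1) * kCol (θ.d₆ + 1) (θ.ℓ₆ + 1) + 8 * ((θ.d₆ : ℝ) + 2) ^ 2) * Real.sqrt (2 * (N : ℝ) * θ.b₁))
              * (2 * Real.sqrt (2 * θ.b₁)
                + α₀' * (2 * ((θ.d₆ : ℝ) + 1) * kCol (θ.d₆ + 1) (θ.ℓ₆ + 1) + 8 * ((θ.d₆ : ℝ) + 2) ^ 2) * Real.sqrt (2 * (N : ℝ) * θ.b₁)) < γ →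
          PosDefTr (fun _ => (1 : ℝ))
            (deltaAQY x.toKIdx (QknitY x.toKIdx) 𝔮s (parKnitY x.toKIdx) (GpY x.toKIdx (parKnitY x.toKIdx)) U) := by
  obtain ⟨M₁, a₁, γ, hM₁, ha₁, hγ, h⟩ := posDefTr_deltaAQY_QknitY_of_laws (N := N) θ Mstar hδA hKA
  refine ⟨M₁, a₁, γ, hM₁, ha₁, hγ, fun x hsurj hM α₀ hα ha U hU hunit hE 𝔮s hQ α₀' hα' hαQ hK hβ => ?_⟩
  exact h x hsurj hM α₀ hα ha U hU (parKnitY x.toKIdx) (GpY x.toKIdx (parKnitY x.toKIdx)) hunit hE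
    (deltaAY_parKnitY_isSymmTr_at_member θ Mstar x hα hU hα' hαQ hK)
    (trIP_RY_parKnitY_self_nonneg_at_member θ Mstar x hα hU hα' hαQ hK) 𝔮s hQ α₀' hα' hαQ hK hβ

end Record

/-! ## §3 ★★★ At the knit pair OF RECORD `(qKnitOfRecord, qsKnitOfRecord)`: the species of the «K» certificate's displayed row-17 law -/

section KnitRecord

open scoped Matrix.Norms.L2Operator
open B7Prop2SpecialUnitary
open Literature.MathematicalPhysics.QuantumFieldTheory.Balaban1983to89.B9Thm311AdjointPairs (isSymmTr_sandwich_of_isAdjTr isSymmTr_QsY_aY_QY aK_isSymm isSymmTr_sub)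
open Literature.MathematicalPhysics.QuantumFieldTheory.Balaban1983to89.B9Thm311DeltaPrimeSymm (isSymmTr_add)
open Literature.MathematicalPhysics.QuantumFieldTheory.Balaban1983to89.B9Thm311InputsAtOne (isSymmTr_liftOpY)
open Literature.MathematicalPhysics.QuantumFieldTheory.Balaban1983to89.Node00.OpsYQLetter (qKnitOfRecord qsKnitOfRecord isAdjTr_adjTrY adjTrY)

variable {N : ℕ}

/-- **SYMMETRY OF `Δ_a^𝔮(U)` FROM THAT OF `Δ_a(U)`** at any site transporter `(parS, Gp)`: `Δ_a^𝔮 = Δ_a − Q\*aQ + 𝔮s a 𝔮` (def-Y's `deltaAQY` vs `deltaAY`), the two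
averaging terms being adjoint sandwiches of the symmetric weight `a` (`G`-valued `U`, `G ≤ U(N)`, for the taxi legs of `Q = QY parBY`; `(𝔮 U, 𝔮s U)` adjoint).
[cite: Balaban1985BackgroundPropagators, (3.26) p.395, (3.12)–(3.13) pp.392–393, Thm 3.11 p.416 («a symmetric … operator»)] -/
theorem deltaAQY_isSymmTr_of_deltaAY {d ℓ : ℕ} {hd : 1 ≤ d + 1} {hL : Odd (ℓ + 1) ∧ 1 < ℓ + 1} {b₀ b₁ : ℝ} (i : KIdx d ℓ hd hL b₀ b₁)
    {G : Subgroup (Matrix (Fin N) (Fin N) ℂ)ˣ} (hG : G ≤ B7Prop2Explicit.unitaryUnits (Matrix (Fin N) (Fin N) ℂ))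
    (parS : SiteParY (Matrix (Fin N) (Fin N) ℂ) i) (Gp : SiteOpY (Matrix (Fin N) (Fin N) ℂ) i) {U : CfgY (Matrix (Fin N) (Fin N) ℂ) i}
    (hU : ∀ μ x, U μ x ∈ G)
    {𝔮 : CfgY (Matrix (Fin N) (Fin N) ℂ) i → ((FBondY i → Matrix (Fin N) (Fin N) ℂ) →ₗ[ℂ] (IBondY i → Matrix (Fin N) (Fin N) ℂ))}
    {𝔮s : CfgY (Matrix (Fin N) (Fin N) ℂ) i → ((IBondY i → Matrix (Fin N) (Fin N) ℂ) →ₗ[ℂ] (FBondY i → Matrix (Fin N) (Fin N) ℂ))}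
    (hQ : IsAdjTr (fun _ => (1 : ℝ)) (fun _ => (1 : ℝ)) (𝔮 U) (𝔮s U)) (hY : IsSymmTr (fun _ => (1 : ℝ)) (deltaAY i parS (parBY i) Gp U)) :
    IsSymmTr (fun _ => (1 : ℝ)) (deltaAQY i 𝔮 𝔮s parS Gp U) := by
  have hQQ : IsSymmTr (fun _ => (1 : ℝ)) (QsY i (parBY i) U ∘ₗ aY i ∘ₗ QY i (parBY i) U) :=
    isSymmTr_QsY_aY_QY i hG (parBY i) U (fun s s' => parBY_mem i hU s s') (aK_isSymm i)
  have hq : IsSymmTr (fun _ => (1 : ℝ)) (𝔮s U ∘ₗ aY i ∘ₗ 𝔮 U) := isSymmTr_sandwich_of_isAdjTr hQ (isSymmTr_liftOpY (aK i) (aK_isSymm i))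
  have hsum := isSymmTr_add (fun _ => (1 : ℝ)) (isSymmTr_sub hY hQQ) hq
  have heq : deltaAY i parS (parBY i) Gp U - QsY i (parBY i) U ∘ₗ aY i ∘ₗ QY i (parBY i) U + 𝔮s U ∘ₗ aY i ∘ₗ 𝔮 U
      = deltaAQY i 𝔮 𝔮s parS Gp U := by
    simp only [deltaAY, deltaAQY]
    abel
  rw [heq] at hsum
  exact hsum

variable [Nonempty (Fin N)] (θ : Stage3Params) (Mstar : ℕ)

/-- ★★ **THE SYMMETRY HALF OF THE «K» ROW-17 LAW IS A THEOREM AT EVERY MEMBER** (no Theorem 3.3, no section): for an `SU(N)`-valued `U ∈ (bg9YP … x).Reg335 c₃₅ α₀`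
(`0 < α₀`) and the knit numerics `0 < α₀′ ≤ α_Q`, `K_pl(Mα₀)L⁴ < α₀′`, `Δ_a^𝔮(U)` at the knit pair of record `(qKnitOfRecord, qsKnitOfRecord)` and the knit site table
`(parKnitY, GpY parKnitY)` is symmetric for the trace pairing. [cite: Balaban1985BackgroundPropagators, Thm 3.11 p.416, (3.24)–(3.27) pp.394–395, (3.13) p.393, (3.35) p.396] -/
theorem deltaAQY_knitRecord_isSymmTr_at_member (x : MemberY θ.d₆ θ.ℓ₆ θ.hd' θ.hL' θ.b₀ θ.b₁ Mstar) {α₀ : ℝ} (hα : 0 < α₀)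
    {U : CfgY (Matrix (Fin N) (Fin N) ℂ) x.toKIdx} (hU : (bg9YP (Matrix (Fin N) (Fin N) ℂ) (specialUnitaryUnits (Fin N)) x).Reg335 c35Y α₀ U)
    {α₀' : ℝ} (hα' : 0 < α₀') (hαQ : α₀' ≤ alphaQ (θ.d₆ + 1) (θ.ℓ₆ + 1))
    (hK : Kpl x.toKIdx ((geo9Y x).M * α₀) * (((θ.ℓ₆ : ℝ) + 1)) ^ 4 < α₀') :
    IsSymmTr (fun _ => (1 : ℝ)) (deltaAQY x.toKIdx (qKnitOfRecord N θ x.toKIdx) (qsKnitOfRecord N θ x.toKIdx) (parKnitY x.toKIdx)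
      (GpY x.toKIdx (parKnitY x.toKIdx)) U) :=
  deltaAQY_isSymmTr_of_deltaAY x.toKIdx le_rfl (parKnitY x.toKIdx) (GpY x.toKIdx (parKnitY x.toKIdx))
    (fun μ y => specialUnitaryUnits_le_unitaryUnits (hU.1.1 μ y)) (isAdjTr_adjTrY (QknitY x.toKIdx U))
    (deltaAY_parKnitY_isSymmTr_at_member θ Mstar x hα hU hα' hαQ hK)

/-- ★★★ **THE «K» ROW-17 LAW AT SECTION-CARRYING MEMBERS ON (3.35), REDUCED TO THEOREM 3.3's BLOCK AT `parKnitY`**: for `δ_A > 0`, `K_A ≥ 0` there are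
`M₁, a₁, γ > 0` such that for `β` onto, `M₁ ≦ M`, `0 < α₀`, `Mα₀ ≦ a₁`, `SU(N)`-valued `U ∈ (bg9YP … x).Reg335 c₃₅ α₀`, Theorem 3.3's block AT `parKnitY` and the x-free
numerics `0 < α₀′ ≤ α_Q`, `K_pl(Mα₀)L⁴ < α₀′`, `δ(2√(2b₁)+δ) < γ`: `Δ_a^𝔮(U)` at `(qKnitOfRecord, qsKnitOfRecord, parKnitY, GpY parKnitY)` is symmetric AND positive
definite — the conjunction dag-n06-d's «KA» displays as `hΔAK`. [cite: Balaban1985BackgroundPropagators, Thm 3.11 p.416; Thm 3.3 p.399; (3.26) p.395; (3.35) p.396;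
(3.115) p.419; Balaban1985Averaging, Prop. 2 p.26, (139)–(147) pp.39–40] -/
theorem symm_posDefTr_deltaAQY_knitRecord_of_block {δA KA : ℝ} (hδA : 0 < δA) (hKA : 0 ≤ KA) :
    ∃ M₁ a₁ γ : ℝ, 0 < M₁ ∧ 0 < a₁ ∧ 0 < γ ∧
    ∀ (x : MemberY θ.d₆ θ.ℓ₆ θ.hd' θ.hL' θ.b₀ θ.b₁ Mstar), Function.Surjective (β x.hN x.D x.hk) → M₁ ≤ (geo9Y x).M →
      ∀ α₀ : ℝ, 0 < α₀ → (geo9Y x).M * α₀ ≤ a₁ →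
      ∀ U : CfgY (Matrix (Fin N) (Fin N) ℂ) x.toKIdx,
        (bg9YP (Matrix (Fin N) (Fin N) ℂ) (specialUnitaryUnits (Fin N)) x).Reg335 c35Y α₀ U →
          IsUnit (deltaAY x.toKIdx (parKnitY x.toKIdx) (parBY x.toKIdx) (GpY x.toKIdx (parKnitY x.toKIdx)) U) →
          EBlock (kernelFamilyBInv x.toKIdx (bg9YP (Matrix (Fin N) (Fin N) ℂ) (specialUnitaryUnits (Fin N)) x) (fun V => V)
            (GAY x.toKIdx (parKnitY x.toKIdx) (parBY x.toKIdx) (GpY x.toKIdx (parKnitY x.toKIdx))) (parBY x.toKIdx)) KA δA U →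
        ∀ α₀' : ℝ, 0 < α₀' → α₀' ≤ alphaQ (θ.d₆ + 1) (θ.ℓ₆ + 1) →
          Kpl x.toKIdx ((geo9Y x).M * α₀) * (((θ.ℓ₆ : ℝ) + 1)) ^ 4 < α₀' →
          (α₀' * (2 * ((θ.d₆ : ℝ) + 1) * kCol (θ.d₆ + 1) (θ.ℓ₆ + 1) + 8 * ((θ.d₆ : ℝ) + 2) ^ 2) * Real.sqrt (2 * (N : ℝ) * θ.b₁))
              * (2 * Real.sqrt (2 * θ.b₁)
                + α₀' * (2 * ((θ.d₆ : ℝ) + 1) * kCol (θ.d₆ + 1) (θ.ℓ₆ + 1) + 8 * ((θ.d₆ : ℝ) + 2) ^ 2) * Real.sqrt (2 * (N : ℝ) * θ.b₁)) < γ →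
          IsSymmTr (fun _ => (1 : ℝ)) (deltaAQY x.toKIdx (qKnitOfRecord N θ x.toKIdx) (qsKnitOfRecord N θ x.toKIdx) (parKnitY x.toKIdx)
              (GpY x.toKIdx (parKnitY x.toKIdx)) U) ∧
            PosDefTr (fun _ => (1 : ℝ)) (deltaAQY x.toKIdx (qKnitOfRecord N θ x.toKIdx) (qsKnitOfRecord N θ x.toKIdx) (parKnitY x.toKIdx)
              (GpY x.toKIdx (parKnitY x.toKIdx)) U) := by
  obtain ⟨M₁, a₁, γ, hM₁, ha₁, hγ, h⟩ := posDefTr_deltaAQY_QknitY_parKnitY_of_block (N := N) θ Mstar hδA hKA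
  refine ⟨M₁, a₁, γ, hM₁, ha₁, hγ, fun x hsurj hM α₀ hα ha U hU hunit hE α₀' hα' hαQ hK hβ => ⟨?_, ?_⟩⟩
  · exact deltaAQY_knitRecord_isSymmTr_at_member θ Mstar x hα hU hα' hαQ hK
  · exact h x hsurj hM α₀ hα ha U hU hunit hE (qsKnitOfRecord N θ x.toKIdx) (isAdjTr_adjTrY (QknitY x.toKIdx U)) α₀' hα' hαQ hK hβ

/-- ★★★ **THE SAME ON THE REGIME OF RECORD `bg9YR … R₁ R₂`** (the «K» certificate's class, its inclusion `hRP1` into (3.35) displayed as there, threshold `c > 0`):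
smallness in the certificate's shape `M·α₀ ≦ a₁ ∕ c`, the fourth-power window in the census letter `(kGeo x).L`. [cite: Balaban1985BackgroundPropagators, Thm 3.11 p.416 with (3.35) p.396; Thm 3.3 p.399] -/
theorem symm_posDefTr_deltaAQY_knitRecord_of_block_regYR {δA KA : ℝ} (hδA : 0 < δA) (hKA : 0 ≤ KA)
    {R₁ R₂ : B9BackgroundsKLevelV1R.RegFamY θ.d₆ θ.ℓ₆ θ.hd' θ.hL' θ.b₀ θ.b₁ Mstar (Matrix (Fin N) (Fin N) ℂ)} {c : ℝ} (hc : 0 < c)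
    (hRP1 : ∀ (x : MemberY θ.d₆ θ.ℓ₆ θ.hd' θ.hL' θ.b₀ θ.b₁ Mstar) (α₀ : ℝ)
      (U : (B9BackgroundsKLevelV1R.bg9YR (Matrix (Fin N) (Fin N) ℂ) (specialUnitaryUnits (Fin N)) R₁ R₂ x).Cfg),
      (B9BackgroundsKLevelV1R.bg9YR (Matrix (Fin N) (Fin N) ℂ) (specialUnitaryUnits (Fin N)) R₁ R₂ x).Reg335 c α₀ U →
        0 ≤ α₀ ∧ (bg9YP (Matrix (Fin N) (Fin N) ℂ) (specialUnitaryUnits (Fin N)) x).Reg335 c35Y α₀ U) :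
    ∃ M₁ a₁ γ : ℝ, 0 < M₁ ∧ 0 < a₁ ∧ 0 < γ ∧
    ∀ (x : MemberY θ.d₆ θ.ℓ₆ θ.hd' θ.hL' θ.b₀ θ.b₁ Mstar), Function.Surjective (β x.hN x.D x.hk) → M₁ ≤ (geo9Y x).M →
      ∀ α₀ : ℝ, 0 < α₀ → (geo9Y x).M * α₀ ≤ a₁ / c →
      ∀ U : (B9BackgroundsKLevelV1R.bg9YR (Matrix (Fin N) (Fin N) ℂ) (specialUnitaryUnits (Fin N)) R₁ R₂ x).Cfg,
        (B9BackgroundsKLevelV1R.bg9YR (Matrix (Fin N) (Fin N) ℂ) (specialUnitaryUnits (Fin N)) R₁ R₂ x).Reg335 c α₀ U →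
          IsUnit (deltaAY x.toKIdx (parKnitY x.toKIdx) (parBY x.toKIdx) (GpY x.toKIdx (parKnitY x.toKIdx)) U) →
          EBlock (kernelFamilyBInv x.toKIdx (bg9YP (Matrix (Fin N) (Fin N) ℂ) (specialUnitaryUnits (Fin N)) x) (fun V => V)
            (GAY x.toKIdx (parKnitY x.toKIdx) (parBY x.toKIdx) (GpY x.toKIdx (parKnitY x.toKIdx))) (parBY x.toKIdx)) KA δA U →
        ∀ α₀' : ℝ, 0 < α₀' → α₀' ≤ alphaQ (θ.d₆ + 1) (θ.ℓ₆ + 1) →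
          Kpl x.toKIdx ((geo9Y x).M * α₀) * (kGeo x.toKIdx).L ^ 4 < α₀' →
          (α₀' * (2 * ((θ.d₆ : ℝ) + 1) * kCol (θ.d₆ + 1) (θ.ℓ₆ + 1) + 8 * ((θ.d₆ : ℝ) + 2) ^ 2) * Real.sqrt (2 * (N : ℝ) * θ.b₁))
              * (2 * Real.sqrt (2 * θ.b₁)
                + α₀' * (2 * ((θ.d₆ : ℝ) + 1) * kCol (θ.d₆ + 1) (θ.ℓ₆ + 1) + 8 * ((θ.d₆ : ℝ) + 2) ^ 2) * Real.sqrt (2 * (N : ℝ) * θ.b₁)) < γ →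
          IsSymmTr (fun _ => (1 : ℝ)) (deltaAQY x.toKIdx (qKnitOfRecord N θ x.toKIdx) (qsKnitOfRecord N θ x.toKIdx) (parKnitY x.toKIdx)
              (GpY x.toKIdx (parKnitY x.toKIdx)) U) ∧
            PosDefTr (fun _ => (1 : ℝ)) (deltaAQY x.toKIdx (qKnitOfRecord N θ x.toKIdx) (qsKnitOfRecord N θ x.toKIdx) (parKnitY x.toKIdx)
              (GpY x.toKIdx (parKnitY x.toKIdx)) U) := by
  obtain ⟨M₁, a₁, γ, hM₁, ha₁, hγ, h⟩ := symm_posDefTr_deltaAQY_knitRecord_of_block (N := N) θ Mstar hδA hKA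
  refine ⟨M₁, a₁ * c, γ, hM₁, by positivity, hγ, fun x hsurj hM α₀ hα ha U hU hunit hE α₀' hα' hαQ hK hβ => ?_⟩
  have hac : a₁ * c / c = a₁ := by field_simp
  have ha' : (geo9Y x).M * α₀ ≤ a₁ := by rw [hac] at ha; exact ha
  have hLK : (kGeo x.toKIdx).L = (θ.ℓ₆ : ℝ) + 1 := by show (((θ.ℓ₆ + 1 : ℕ) : ℝ)) = _; push_cast; ring
  have hK' : Kpl x.toKIdx ((geo9Y x).M * α₀) * (((θ.ℓ₆ : ℝ) + 1)) ^ 4 < α₀' := by rw [← hLK]; exact hK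
  exact h x hsurj hM α₀ hα ha' U (hRP1 x α₀ U hU).2 hunit hE α₀' hα' hαQ hK' hβ

end KnitRecord

end Literature.MathematicalPhysics.QuantumFieldTheory.Balaban1983to89.B9Thm311PosDefQknitAtKnitSiteTableY

end
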